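import Summits.AtomisticToContinuum.HydrodynamicLimit.Theorems.JParityClosureParityRigidityLayerCake

/-!
# Gaussian relative differentiation of measures (helper for `ParityRigidity`)

For finite measures `μ, ν` on a finite-dimensional real inner product space `F`, the ratio of
Gaussian averages `(∫ e^{-‖x-z‖²/s} dν(z)) / (∫ e^{-‖x-z‖²/s} dμ(z))` converges to the
Radon–Nikodym derivative `dν/dμ (x)` as `s → 0⁺`, for `μ`-a.e. `x`
(`ae_tendsto_lintegral_exp_div`).  Proof: Besicovitch differentiation along closed balls
(`Besicovitch.ae_tendsto_rnDeriv`) fed into the layer-cake sandwich of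
`JParityClosureParityRigidityLayerCake`; the Gaussian tails are negligible because `μ`-almost
every point carries at least polynomial ball mass (`ae_exists_mul_pow_le_measure_closedBall`,
differentiation of Lebesgue measure with respect to `μ`).

Helper file for item stmt-AtomisticToContinuum-13084 (route JParityClosure, decl `ParityRigidity`).
-/

open MeasureTheory Metric Real Filter Topology Set
open scoped ENNReal NNReal Topology

namespace Summit.AtomisticToContinuum.HydrodynamicLimit.Theorems.ParityRigidity

variable {F : Type*} [NormedAddCommGroup F] [InnerProductSpace ℝ F] [FiniteDimensional ℝ F]
  [MeasurableSpace F] [BorelSpace F]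

/-- `μ`-almost every point carries at least polynomial ball mass:
`c · r ^ dim F ≤ μ (closedBall x r)` for small `r`, with `c ≠ 0`. -/
theorem ae_exists_mul_pow_le_measure_closedBall (μ : Measure F) [IsFiniteMeasure μ] :
    ∀ᵐ x ∂μ, ∃ c : ℝ≥0∞, c ≠ 0 ∧ ∃ r₀ : ℝ, 0 < r₀ ∧
      ∀ r ∈ Ioo 0 r₀, c * ENNReal.ofReal (r ^ Module.finrank ℝ F) ≤ μ (closedBall x r) := by
  filter_upwards [Besicovitch.ae_tendsto_rnDeriv (volume : Measure F) μ,
    Measure.rnDeriv_lt_top (volume : Measure F) μ] with x hx hfin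
  set L := (volume : Measure F).rnDeriv μ x with hL
  have hne : L + 1 ≠ ⊤ := ENNReal.add_ne_top.2 ⟨hfin.ne, ENNReal.one_ne_top⟩
  have hlt : L < L + 1 := ENNReal.lt_add_right hfin.ne one_ne_zero
  have hne0 : L + 1 ≠ 0 := (lt_of_le_of_lt (zero_le (a := L)) hlt).ne'
  have hev : ∀ᶠ r in 𝓝[>] (0 : ℝ), volume (closedBall x r) / μ (closedBall x r) < L + 1 :=
    hx.eventually (gt_mem_nhds hlt)
  obtain ⟨r₀, hr₀, hr⟩ := (nhdsGT_basis (0 : ℝ)).eventually_iff.1 hev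
  refine ⟨volume (closedBall (0 : F) 1) / (L + 1), ?_, r₀, hr₀, fun r hrI => ?_⟩
  · exact (ENNReal.div_pos (measure_closedBall_pos volume _ zero_lt_one).ne' hne).ne'
  · have h1 : volume (closedBall x r) / μ (closedBall x r) < L + 1 := hr hrI
    have h2 : volume (closedBall x r) ≤ (L + 1) * μ (closedBall x r) :=
      (ENNReal.div_le_iff_le_mul (Or.inr hne) (Or.inr hne0)).1 h1.le
    rw [Measure.addHaar_closedBall' volume x hrI.1.le] at h2
    calc volume (closedBall (0 : F) 1) / (L + 1) * ENNReal.ofReal (r ^ Module.finrank ℝ F)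
        = ENNReal.ofReal (r ^ Module.finrank ℝ F) * volume (closedBall (0 : F) 1) / (L + 1) := by
          rw [mul_comm, mul_div_assoc]
      _ ≤ (L + 1) * μ (closedBall x r) / (L + 1) := by gcongr
      _ = μ (closedBall x r) := by rw [mul_comm, ENNReal.mul_div_cancel_right hne0 hne]

omit [InnerProductSpace ℝ F] [FiniteDimensional ℝ F] in
/-- **The sandwich.** If at `x` the ball ratios `ν (B̄(x,r)) / μ (B̄(x,r))` converge to a finite
limit `L` as `r → 0⁺` and `μ`-balls around `x` have at least polynomial mass, then the ratio of
the Gaussian averages converges to `L` as the variance parameter `s → 0⁺`. -/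
theorem tendsto_lintegral_exp_div_of_tendsto_closedBall [NormedSpace ℝ F] (μ ν : Measure F)
    [IsFiniteMeasure μ] [IsFiniteMeasure ν] (x : F) {L : ℝ≥0∞} (hL : L ≠ ⊤)
    (hlim : Tendsto (fun r => ν (closedBall x r) / μ (closedBall x r)) (𝓝[>] 0) (𝓝 L))
    {c : ℝ≥0∞} (hc0 : c ≠ 0) {d : ℕ} {r₀ : ℝ} (hr₀ : 0 < r₀)
    (hball : ∀ r ∈ Ioo 0 r₀, c * ENNReal.ofReal (r ^ d) ≤ μ (closedBall x r)) :
    Tendsto (fun s : ℝ => (∫⁻ z, ENNReal.ofReal (Real.exp (-‖x - z‖ ^ 2 / s)) ∂ν) /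
      ∫⁻ z, ENNReal.ofReal (Real.exp (-‖x - z‖ ^ 2 / s)) ∂μ) (𝓝[>] 0) (𝓝 L) := by
  set Nμ : ℝ → ℝ≥0∞ := fun s => ∫⁻ z, ENNReal.ofReal (Real.exp (-‖x - z‖ ^ 2 / s)) ∂μ with hNμ
  set Nν : ℝ → ℝ≥0∞ := fun s => ∫⁻ z, ENNReal.ofReal (Real.exp (-‖x - z‖ ^ 2 / s)) ∂ν with hNν
  rw [ENNReal.tendsto_nhds hL]
  intro ε hε
  rcases eq_or_ne ε ⊤ with rfl | hεtop
  · exact Eventually.of_forall fun s => ⟨by simp, by simp⟩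
  set ε' := ε / 2 with hε'
  have hε'0 : ε' ≠ 0 := (ENNReal.div_pos hε.ne' ENNReal.ofNat_ne_top).ne'
  have hε'pos : 0 < ε' := pos_iff_ne_zero.2 hε'0
  have hε'top : ε' ≠ ⊤ := ENNReal.div_ne_top hεtop two_ne_zero
  have hεsum : ε' + ε' = ε := ENNReal.add_halves ε
  have hLε'top : L + ε' ≠ ⊤ := ENNReal.add_ne_top.2 ⟨hL, hε'top⟩
  have hLε'top' : L - ε' ≠ ⊤ := ENNReal.sub_ne_top hL
  -- Step 1: ball-ratio control for radii `r < δ`.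
  have hev : ∀ᶠ r in 𝓝[>] (0 : ℝ),
      ν (closedBall x r) / μ (closedBall x r) ∈ Icc (L - ε') (L + ε') :=
    (ENNReal.tendsto_nhds hL).1 hlim ε' hε'pos
  obtain ⟨δ₁, hδ₁, hδ⟩ := (nhdsGT_basis (0 : ℝ)).eventually_iff.1 hev
  set δ := min δ₁ r₀ with hδdef
  have hδ0 : 0 < δ := lt_min hδ₁ hr₀
  have hμB : ∀ r ∈ Ioo 0 δ, μ (closedBall x r) ≠ 0 := by
    intro r hr h0
    have h := hball r ⟨hr.1, hr.2.trans_le (min_le_right _ _)⟩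
    rw [h0, nonpos_iff_eq_zero, mul_eq_zero] at h
    rcases h with h | h
    · exact hc0 h
    · rw [ENNReal.ofReal_eq_zero] at h
      exact absurd h (not_le.2 (pow_pos hr.1 d))
  have hup : ∀ r ∈ Ioo 0 δ, ν (closedBall x r) ≤ (L + ε') * μ (closedBall x r) := by
    intro r hr
    have h := (hδ ⟨hr.1, hr.2.trans_le (min_le_left _ _)⟩).2
    exact (ENNReal.div_le_iff_le_mul (Or.inl (hμB r hr)) (Or.inl (measure_ne_top μ _))).1 h
  have hlow : ∀ r ∈ Ioo 0 δ, (L - ε') * μ (closedBall x r) ≤ ν (closedBall x r) := by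
    intro r hr
    have h := (hδ ⟨hr.1, hr.2.trans_le (min_le_left _ _)⟩).1
    exact (ENNReal.le_div_iff_mul_le (Or.inl (hμB r hr)) (Or.inl (measure_ne_top μ _))).1 h
  -- Step 2: the Gaussian tails are negligible against `Nμ`.
  have htail := tendsto_exp_div_lintegral_exp μ x hc0 hr₀ hball hδ0
  have htailν : Tendsto (fun s : ℝ => ν univ *
      (ENNReal.ofReal (Real.exp (-δ ^ 2 / s)) / Nμ s)) (𝓝[>] 0) (𝓝 0) := by
    have h := ENNReal.Tendsto.const_mul htail (Or.inr (measure_ne_top ν univ))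
    rwa [mul_zero] at h
  have htailμ : Tendsto (fun s : ℝ => (L - ε') * μ univ *
      (ENNReal.ofReal (Real.exp (-δ ^ 2 / s)) / Nμ s)) (𝓝[>] 0) (𝓝 0) := by
    have h := ENNReal.Tendsto.const_mul htail
      (Or.inr (ENNReal.mul_ne_top hLε'top' (measure_ne_top μ univ)))
    rwa [mul_zero] at h
  -- Step 3: the two-sided estimate for small `s`.
  filter_upwards [self_mem_nhdsWithin, ENNReal.tendsto_nhds_zero.1 htailν ε' hε'pos,
    ENNReal.tendsto_nhds_zero.1 htailμ ε' hε'pos] with s hs hts1 hts2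
  have hs0 : 0 < s := hs
  have hNμtop : Nμ s ≠ ⊤ := (lintegral_exp_neg_norm_sq_div_lt_top μ x hs0).ne
  have hNμpos : Nμ s ≠ 0 := by
    set r := min (Real.sqrt s / 2) (δ / 2) with hrdef
    have hsq : 0 < Real.sqrt s := Real.sqrt_pos.2 hs0
    have hr0 : 0 < r := lt_min (by positivity) (by positivity)
    have hrδ : r < δ := (min_le_right _ _).trans_lt (by linarith)
    have hrs : r ≤ Real.sqrt s := (min_le_left _ _).trans (by linarith)
    have h1 : μ (closedBall x r) ≤ μ (closedBall x (Real.sqrt s)) :=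
      measure_mono (closedBall_subset_closedBall hrs)
    have h2 := mul_measure_closedBall_sqrt_le_lintegral_exp μ x hs0
    intro h0
    have h3 : ENNReal.ofReal (Real.exp (-1)) * μ (closedBall x (Real.sqrt s)) = 0 :=
      le_antisymm (h2.trans (le_of_eq h0)) bot_le
    rw [mul_eq_zero, ENNReal.ofReal_eq_zero] at h3
    rcases h3 with h3 | h3
    · exact absurd h3 (not_le.2 (Real.exp_pos _))
    · exact hμB r ⟨hr0, hrδ⟩ (le_antisymm ((h1.trans (le_of_eq h3))) bot_le)
  -- the middle layer-cake integrals
  set Jμ := ∫⁻ t in Ioo (Real.exp (-δ ^ 2 / s)) 1,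
    μ (closedBall x (Real.sqrt (s * Real.log t⁻¹))) with hJμ
  set Jν := ∫⁻ t in Ioo (Real.exp (-δ ^ 2 / s)) 1,
    ν (closedBall x (Real.sqrt (s * Real.log t⁻¹))) with hJν
  set eδ := ENNReal.ofReal (Real.exp (-δ ^ 2 / s)) with heδ
  have hJν_le : Jν ≤ (L + ε') * Jμ := by
    calc Jν ≤ ∫⁻ t in Ioo (Real.exp (-δ ^ 2 / s)) 1,
          (L + ε') * μ (closedBall x (Real.sqrt (s * Real.log t⁻¹))) :=
          setLIntegral_mono' measurableSet_Ioo fun t ht =>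
            hup _ (sqrt_mul_log_inv_mem_Ioo hs0 hδ0 ht)
      _ = (L + ε') * Jμ := lintegral_const_mul' _ _ hLε'top
  have hJμ_le : (L - ε') * Jμ ≤ Jν := by
    calc (L - ε') * Jμ ≤ ∫⁻ t in Ioo (Real.exp (-δ ^ 2 / s)) 1,
          (L - ε') * μ (closedBall x (Real.sqrt (s * Real.log t⁻¹))) :=
          lintegral_const_mul_le _ _
      _ ≤ Jν := setLIntegral_mono' measurableSet_Ioo fun t ht =>
            hlow _ (sqrt_mul_log_inv_mem_Ioo hs0 hδ0 ht)
  have hNν_up : Nν s ≤ eδ * ν univ + (L + ε') * Nμ s :=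
    calc Nν s ≤ eδ * ν univ + Jν := lintegral_exp_le_add_setLIntegral_Ioo ν x hs0
      _ ≤ eδ * ν univ + (L + ε') * Jμ := add_le_add le_rfl hJν_le
      _ ≤ eδ * ν univ + (L + ε') * Nμ s := by
          gcongr
          exact setLIntegral_Ioo_le_lintegral_exp μ x hs0
  have hNμ_up : (L - ε') * Nμ s ≤ (L - ε') * μ univ * eδ + Nν s :=
    calc (L - ε') * Nμ s ≤ (L - ε') * (eδ * μ univ + Jμ) := by
          gcongr
          exact lintegral_exp_le_add_setLIntegral_Ioo μ x hs0
      _ = (L - ε') * μ univ * eδ + (L - ε') * Jμ := by ring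
      _ ≤ (L - ε') * μ univ * eδ + Jν := add_le_add le_rfl hJμ_le
      _ ≤ (L - ε') * μ univ * eδ + Nν s :=
          add_le_add le_rfl (setLIntegral_Ioo_le_lintegral_exp ν x hs0)
  constructor
  · -- lower bound
    rw [← hεsum, ← tsub_tsub]
    refine tsub_le_iff_right.2 ?_
    have h1 : L - ε' ≤ ((L - ε') * μ univ * eδ + Nν s) / Nμ s :=
      (ENNReal.le_div_iff_mul_le (Or.inl hNμpos) (Or.inl hNμtop)).2 hNμ_up
    calc L - ε' ≤ ((L - ε') * μ univ * eδ + Nν s) / Nμ s := h1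
      _ = (L - ε') * μ univ * (eδ / Nμ s) + Nν s / Nμ s := by
          rw [ENNReal.add_div, mul_div_assoc]
      _ ≤ ε' + Nν s / Nμ s := add_le_add hts2 le_rfl
      _ = Nν s / Nμ s + ε' := add_comm _ _
  · -- upper bound
    calc Nν s / Nμ s ≤ (eδ * ν univ + (L + ε') * Nμ s) / Nμ s := by gcongr
      _ = ν univ * (eδ / Nμ s) + (L + ε') * Nμ s / Nμ s := by
          rw [ENNReal.add_div, mul_comm eδ, mul_div_assoc]
      _ = ν univ * (eδ / Nμ s) + (L + ε') := by
          rw [ENNReal.mul_div_cancel_right hNμpos hNμtop]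
      _ ≤ ε' + (L + ε') := add_le_add hts1 le_rfl
      _ = L + ε := by rw [← hεsum]; ring

/-- **Gaussian relative differentiation.** For finite measures `μ, ν` on a finite-dimensional
real inner product space, the ratio of Gaussian averages
`(∫ e^{-‖x-z‖²/s} dν) / (∫ e^{-‖x-z‖²/s} dμ)` tends to the Radon–Nikodym derivative `dν/dμ (x)`
as `s → 0⁺`, for `μ`-almost every `x`. -/
theorem ae_tendsto_lintegral_exp_div (μ ν : Measure F) [IsFiniteMeasure μ] [IsFiniteMeasure ν] :
    ∀ᵐ x ∂μ, Tendsto (fun s : ℝ => (∫⁻ z, ENNReal.ofReal (Real.exp (-‖x - z‖ ^ 2 / s)) ∂ν) /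
      ∫⁻ z, ENNReal.ofReal (Real.exp (-‖x - z‖ ^ 2 / s)) ∂μ) (𝓝[>] 0) (𝓝 (ν.rnDeriv μ x)) := by
  filter_upwards [Besicovitch.ae_tendsto_rnDeriv ν μ, Measure.rnDeriv_lt_top ν μ,
    ae_exists_mul_pow_le_measure_closedBall μ] with x hx hfin hball
  obtain ⟨c, hc0, r₀, hr₀, hball⟩ := hball
  exact tendsto_lintegral_exp_div_of_tendsto_closedBall μ ν x hfin.ne hx hc0 hr₀ hball

end Summit.AtomisticToContinuum.HydrodynamicLimit.Theorems.ParityRigidity
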